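import Mathlib
import HarnessLib
import Summits.HubbardSuperconductivity.HubbardSuperconductivity.Theorems.KLProgrammeKLRegimeEngineV8DefsG5Reading

/-!
# K3 engine package `klEngGeo5`: booking a TWO-SHELL (above-resolution) bubble bound of the shape `U²·(a₁·Λ_n/ρ + a₂·√Λ_n)` on the gain profiles
# (cell gate-hubbard-kl, seat hubbard-kl-k3c2-p2 g6; companion of `…EngineV8DefsG5Reading` / `…ReadingForward`)

The above-resolution (transversality + caustic, Lemma E.1/E.3) bound of a two-shell bubble at transfer size `ρ > 0` has the shape `a₁·Λ_n/ρ + a₂·√Λ_n`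
(`Λ_n = klScale klE0 n = klE0·4^{-n}`, `√Λ_n = √klE0·2^{-n}`).  Times the two local couplings `U²` it is hypothesis (3) of `klg5_phGain_reading` /
`klg5_ppGain_reading` as soon as `a₁, a₂ ≤ 2^52` (`= 2^28·2^24`):

* `klg5_sqrt_klScale` (`√Λ_n = √klE0·(2^n)⁻¹`), **`klg5_above_of_twoShell`** (`b ≤ U²(a₁Λ_n/ρ + a₂√Λ_n)`, `0 ≤ a₁ ≤ 2^52`, `0 ≤ a₂ ≤ 2^52`, `ρ > 0`, `Klam ≥ 1`
  ⇒ `b ≤ (Klam U)²·2^28·(2^24·(klE0·4^{-n})/ρ + 2^24·√klE0·2^{-n}) + T` for any `T ≥ 0`).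

Pure order arithmetic; nothing about the model is asserted.
-/

noncomputable section

namespace Summit.HubbardSuperconductivity.HubbardSuperconductivity.Theorems.EngineV8

set_option linter.dupNamespace false -- summit = problem name (single-conjunct summit), D-0017

open Real Finset Literature.MathematicalPhysics.QuantumLattice Literature.Probability.LatticeModels
open Summit.HubbardSuperconductivity.HubbardSuperconductivity.Theorems.KLRegimeSplit
open Summit.HubbardSuperconductivity.HubbardSuperconductivity.Theorems.KLProgrammeLegKernels

/-- `√Λ_n = √klE0 · (2^n)⁻¹`. -/
theorem klg5_sqrt_klScale (n : ℕ) : Real.sqrt (klScale klE0 n) = Real.sqrt klE0 * ((2 : ℝ) ^ n)⁻¹ := by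
  have hsc : klScale klE0 n = klE0 * ((4 : ℝ) ^ n)⁻¹ := rfl
  rw [hsc, Real.sqrt_mul (by unfold klE0; norm_num), Real.sqrt_inv]
  congr 1
  rw [show (4 : ℝ) ^ n = ((2 : ℝ) ^ n) ^ 2 by rw [← pow_mul, mul_comm, pow_mul]; norm_num]
  rw [Real.sqrt_sq (by positivity)]

/-- **Booking a two-shell bound on the gain profiles at `klEngGeo5`.**  If `b ≤ U²·(a₁·Λ_n/ρ + a₂·√Λ_n)` with `0 ≤ a₁ ≤ 2^52`, `0 ≤ a₂ ≤ 2^52`, `ρ > 0`,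
`Klam ≥ 1`, then for every `T ≥ 0`: `b ≤ (Klam U)²·2^28·(2^24·(klE0·4^{-n})/ρ + 2^24·√klE0·2^{-n}) + T` — hypothesis (3) of `klg5_phGain_reading` and of
`klg5_ppGain_reading`. -/
theorem klg5_above_of_twoShell {P : SplitConsts} {U ρ b a₁ a₂ T : ℝ} {n : ℕ} (hK : 1 ≤ P.Klam) (hρ : 0 < ρ) (hT : 0 ≤ T)
    (h1 : 0 ≤ a₁) (h1' : a₁ ≤ 2 ^ 52) (h2 : 0 ≤ a₂) (h2' : a₂ ≤ 2 ^ 52)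
    (hb : b ≤ U ^ 2 * (a₁ * klScale klE0 n / ρ + a₂ * Real.sqrt (klScale klE0 n))) :
    b ≤ (P.Klam * U) ^ 2 * 2 ^ 28 * (2 ^ 24 * (klE0 * ((4 : ℝ) ^ n)⁻¹) / ρ + 2 ^ 24 * Real.sqrt klE0 * ((2 : ℝ) ^ n)⁻¹) + T := by
  have hsc : klScale klE0 n = klE0 * ((4 : ℝ) ^ n)⁻¹ := rfl
  have hΛ : 0 < klScale klE0 n := klth_klScale_pos n
  have hKU : U ^ 2 ≤ (P.Klam * U) ^ 2 := by
    rw [mul_pow]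
    have h1K : (1 : ℝ) ≤ P.Klam ^ 2 := one_le_pow₀ hK
    nlinarith [sq_nonneg U]
  have hKU0 : 0 ≤ (P.Klam * U) ^ 2 := sq_nonneg _
  have hq1 : 0 ≤ klScale klE0 n / ρ := div_nonneg hΛ.le hρ.le
  have hq2 : 0 ≤ Real.sqrt (klScale klE0 n) := Real.sqrt_nonneg _
  have hin : 0 ≤ a₁ * klScale klE0 n / ρ + a₂ * Real.sqrt (klScale klE0 n) := by positivity
  -- `a₁Λ/ρ + a₂√Λ ≤ 2^28·(2^24Λ/ρ + 2^24√Λ)`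
  have hcoef : a₁ * klScale klE0 n / ρ + a₂ * Real.sqrt (klScale klE0 n) ≤
      2 ^ 28 * (2 ^ 24 * (klE0 * ((4 : ℝ) ^ n)⁻¹) / ρ + 2 ^ 24 * Real.sqrt klE0 * ((2 : ℝ) ^ n)⁻¹) := by
    have hs := klg5_sqrt_klScale n
    have e : (2 : ℝ) ^ 28 * (2 ^ 24 * (klE0 * ((4 : ℝ) ^ n)⁻¹) / ρ + 2 ^ 24 * Real.sqrt klE0 * ((2 : ℝ) ^ n)⁻¹) =
        2 ^ 52 * (klScale klE0 n / ρ) + 2 ^ 52 * Real.sqrt (klScale klE0 n) := by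
      rw [hs, hsc]; ring
    rw [e]
    have i1 := mul_le_mul_of_nonneg_right h1' hq1
    have i2 := mul_le_mul_of_nonneg_right h2' hq2
    have e2 : a₁ * klScale klE0 n / ρ = a₁ * (klScale klE0 n / ρ) := by ring
    rw [e2]
    linarith
  calc b ≤ U ^ 2 * (a₁ * klScale klE0 n / ρ + a₂ * Real.sqrt (klScale klE0 n)) := hb
    _ ≤ (P.Klam * U) ^ 2 * (a₁ * klScale klE0 n / ρ + a₂ * Real.sqrt (klScale klE0 n)) := mul_le_mul_of_nonneg_right hKU hin
    _ ≤ (P.Klam * U) ^ 2 * (2 ^ 28 * (2 ^ 24 * (klE0 * ((4 : ℝ) ^ n)⁻¹) / ρ + 2 ^ 24 * Real.sqrt klE0 * ((2 : ℝ) ^ n)⁻¹)) :=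
        mul_le_mul_of_nonneg_left hcoef hKU0
    _ = (P.Klam * U) ^ 2 * 2 ^ 28 * (2 ^ 24 * (klE0 * ((4 : ℝ) ^ n)⁻¹) / ρ + 2 ^ 24 * Real.sqrt klE0 * ((2 : ℝ) ^ n)⁻¹) := by ring
    _ ≤ _ := le_add_of_nonneg_right hT

end Summit.HubbardSuperconductivity.HubbardSuperconductivity.Theorems.EngineV8

end
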